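import Summits.BirchSwinnertonDyer.BirchSwinnertonDyer.Theorems.ResidualThetaTransportAtTwoPlusDualThetaAlgebra
import Literature.NumberTheory.EllipticCurves.PlusMinusPAdicLFunctionProofs
import HarnessLib

/-!
# θ-algebra with coefficients, adjoint (palindromy) congruences, and the degree gap at `p = 2`

Support file for RTT P6 `ResidualLambdaFormulaNegDiscAtTwo` (stmt-BirchSwinnertonDyer-23110), line `hplusdual`, stub `stub_iso`
(ISO = Kim 2007 Prop. 3.15 at `p = 2`), θ-plan, step «θ-EXTRACTION» (LEAD g13 2026-08-28 22:31Z decision (1)).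

* §1 `forall_mem_omegaIdeal_of_compatible_coeff`: the Weierstrass induction of
  `forall_mem_omegaIdeal_of_compatible` (p672599) with the compatibility weakened to
  `∃ w, w·θ m − θ n ∈ I(n, J)` (`I(n, J) = (ω_n) + (p^J)`), which is what generators chosen independently at each
  layer produce; `exists_mul_sub_mem_of_consecutive` derives it from consecutive layers.
* §2 ADJOINT CONGRUENCES («palindromy»): for `u` with `u^N ≡ 1`, the adjoint `Q(u^{N−1})` of a product `Q` of cyclotomic
  polynomials `Φ_{q^{m+1}}` is `u^{−deg Q}·Q(u)` (`pow_mul_aeval_prod_cyclotomic_adjoint_sub_mem`); for the relative norm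
  `ν = Φ_{p^{n+1}}(1+T)` the adjoint is `ν` itself modulo `ω_{n+1}` (`aeval_norm_adjoint_sub_mem`).
* §3 the degree gap `2^{2m} − 2·deg ω̃⁻_{2m} → ∞` at `p = 2` (`exists_gap_cyclotomicOmegaMinus_two`).

References: B.D. Kim, *The parity conjecture for elliptic curves at supersingular reduction primes*, Compos. Math. 143 (2007),
Prop. 3.15 (proof); L. Washington, *Introduction to Cyclotomic Fields*, §7.1, §13.2; R. Pollack, Duke Math. J. 118 (2003), §6.5.
-/

set_option autoImplicit false
-- D-0017: single-problem summit, so `Summit.BirchSwinnertonDyer.BirchSwinnertonDyer.…` repeats a namespace BY DESIGN.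
set_option linter.dupNamespace false

noncomputable section

open scoped Classical
open Polynomial Finset Literature.NumberTheory.EllipticCurves

namespace Summit.BirchSwinnertonDyer.BirchSwinnertonDyer.Theorems.ResidualThetaLayer.PlusDual

/-! ## §1 The Weierstrass induction with coefficients -/

section Theta

variable (p : ℕ) [hp : Fact p.Prime]

/-- **`I(m, J) ⊆ I(n, J)` for `n ≤ m`** (`ω_n ∣ ω_m`). [cite: Washington1997, §13.2] -/
theorem omegaIdeal_le_of_le (J : ℕ) {n m : ℕ} (hnm : n ≤ m) :
    Ideal.span {(((X + 1 : ℤ_[p][X]) ^ p ^ m - 1 : ℤ_[p][X]) : PowerSeries ℤ_[p])} ⊔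
        Ideal.span {PowerSeries.C ((p : ℤ_[p]) ^ J)} ≤
      Ideal.span {(((X + 1 : ℤ_[p][X]) ^ p ^ n - 1 : ℤ_[p][X]) : PowerSeries ℤ_[p])} ⊔
        Ideal.span {PowerSeries.C ((p : ℤ_[p]) ^ J)} := by
  refine sup_le_sup_right (Ideal.span_singleton_le_span_singleton.mpr ?_) _
  refine ⟨((∑ i ∈ range (p ^ (m - n)), ((X + 1 : ℤ_[p][X]) ^ p ^ n) ^ i : ℤ_[p][X]) : PowerSeries ℤ_[p]), ?_⟩
  rw [← Polynomial.coe_mul, ← omega_eq_omega_mul_geom_sum (p := p) hnm]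

/-- **Consecutive compatibility up to coefficients implies compatibility up to coefficients for all `n ≤ m`**:
from `w_n·θ(n+1) − θ n ∈ I(n, J)` for all `n` one gets, for `n ≤ m`, some `w` with `w·θ m − θ n ∈ I(n, J)` (product of the `w_i`,
using `I(i, J) ⊆ I(n, J)` for `i ≥ n`). [cite: BDKim2007, Prop. 3.15 (proof)] -/
theorem exists_mul_sub_mem_of_consecutive (J : ℕ) (θ : ℕ → PowerSeries ℤ_[p])
    (hc : ∀ n, ∃ w : PowerSeries ℤ_[p], w * θ (n + 1) - θ n ∈
      Ideal.span {(((X + 1 : ℤ_[p][X]) ^ p ^ n - 1 : ℤ_[p][X]) : PowerSeries ℤ_[p])} ⊔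
        Ideal.span {PowerSeries.C ((p : ℤ_[p]) ^ J)}) :
    ∀ n m : ℕ, n ≤ m → ∃ w : PowerSeries ℤ_[p], w * θ m - θ n ∈
      Ideal.span {(((X + 1 : ℤ_[p][X]) ^ p ^ n - 1 : ℤ_[p][X]) : PowerSeries ℤ_[p])} ⊔
        Ideal.span {PowerSeries.C ((p : ℤ_[p]) ^ J)} := by
  intro n m hnm
  induction m, hnm using Nat.le_induction with
  | base => exact ⟨1, by rw [one_mul, sub_self]; exact zero_mem _⟩
  | succ m hnm ih =>
    obtain ⟨W, hW⟩ := ih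
    obtain ⟨w, hw⟩ := hc m
    refine ⟨W * w, ?_⟩
    have e1 : W * w * θ (m + 1) - θ n = W * (w * θ (m + 1) - θ m) + (W * θ m - θ n) := by ring
    rw [e1]
    exact add_mem (Ideal.mul_mem_left _ _ (omegaIdeal_le_of_le p J hnm hw)) hW

/-- **θ-ALGEBRA WITH COEFFICIENTS.** Let `θ : ℕ → Λ` be compatible modulo `I(n, J) = (ω_n) + (p^J)` UP TO COEFFICIENTS — for `n ≤ m`
some `w ∈ Λ` has `w·θ m − θ n ∈ I(n, J)` — and suppose that at levels `n_k` it is killed by distinguished `F_k` modulo `I(n_k, J)`,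
`θ(n_k)·F_k ∈ I(n_k, J)`, with an unbounded degree gap `∀ N ∃ k, N + deg F_k ≤ p^{n_k}`. Then `θ n ∈ I(n, J)` for every `n`.
(Same Weierstrass induction on `J` as `forall_mem_omegaIdeal_of_compatible`, the coefficient `w` being absorbed by the ideals at each
step.) In the ISO θ-plan, `θ n` encodes the layer pairing at a generator `g_n` of the cyclic layer `S[p^J, ω_n]`, and generators at
different layers are related only up to a ring element — whence the coefficients. [cite: BDKim2007, Prop. 3.15 (proof, pp. 56–57)]
[cite: Washington1997, §7.1 and §13.2] -/
theorem forall_mem_omegaIdeal_of_compatible_coeff (J : ℕ) (θ : ℕ → PowerSeries ℤ_[p])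
    (hcompat : ∀ n m : ℕ, n ≤ m → ∃ w : PowerSeries ℤ_[p], w * θ m - θ n ∈
      Ideal.span {(((X + 1 : ℤ_[p][X]) ^ p ^ n - 1 : ℤ_[p][X]) : PowerSeries ℤ_[p])} ⊔
        Ideal.span {PowerSeries.C ((p : ℤ_[p]) ^ J)})
    (nk : ℕ → ℕ) (F : ℕ → ℤ_[p][X]) (hF : ∀ k, (F k).IsDistinguishedAt (IsLocalRing.maximalIdeal ℤ_[p]))
    (hgap : ∀ N : ℕ, ∃ k, N + (F k).natDegree ≤ p ^ nk k)
    (hyp : ∀ k, θ (nk k) * (F k : PowerSeries ℤ_[p]) ∈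
      Ideal.span {(((X + 1 : ℤ_[p][X]) ^ p ^ nk k - 1 : ℤ_[p][X]) : PowerSeries ℤ_[p])} ⊔
        Ideal.span {PowerSeries.C ((p : ℤ_[p]) ^ J)}) :
    ∀ n : ℕ, θ n ∈ Ideal.span {(((X + 1 : ℤ_[p][X]) ^ p ^ n - 1 : ℤ_[p][X]) : PowerSeries ℤ_[p])} ⊔
      Ideal.span {PowerSeries.C ((p : ℤ_[p]) ^ J)} := by
  have hCp : (PowerSeries.C (p : ℤ_[p]) : PowerSeries ℤ_[p]) ≠ 0 := by
    intro h
    have := congrArg PowerSeries.constantCoeff h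
    rw [PowerSeries.constantCoeff_C, map_zero] at this
    exact (Nat.cast_ne_zero.mpr hp.out.ne_zero) this
  have hω : ∀ n, (((X + 1 : ℤ_[p][X]) ^ p ^ n - 1 : ℤ_[p][X])).IsDistinguishedAt (IsLocalRing.maximalIdeal ℤ_[p]) :=
    Kato2004.IwasawaH1Exists.isDistinguishedAt_omega p
  have hdiv : ∀ {n m : ℕ}, n ≤ m → ∃ ν : PowerSeries ℤ_[p],
      (((X + 1 : ℤ_[p][X]) ^ p ^ m - 1 : ℤ_[p][X]) : PowerSeries ℤ_[p]) =
        (((X + 1 : ℤ_[p][X]) ^ p ^ n - 1 : ℤ_[p][X]) : PowerSeries ℤ_[p]) * ν := by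
    intro n m hnm
    refine ⟨((∑ i ∈ range (p ^ (m - n)), ((X + 1 : ℤ_[p][X]) ^ p ^ n) ^ i : ℤ_[p][X]) : PowerSeries ℤ_[p]), ?_⟩
    rw [← Polynomial.coe_mul, ← omega_eq_omega_mul_geom_sum (p := p) hnm]
  induction J generalizing θ with
  | zero =>
    intro n
    have htop : Ideal.span {PowerSeries.C ((p : ℤ_[p]) ^ 0)} = ⊤ := by
      rw [pow_zero, map_one, Ideal.span_singleton_one]
    rw [htop, sup_top_eq]; trivial
  | succ J ih =>
    have hCsucc : PowerSeries.C ((p : ℤ_[p]) ^ (J + 1)) = PowerSeries.C (p : ℤ_[p]) * PowerSeries.C ((p : ℤ_[p]) ^ J) := by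
      rw [pow_succ', map_mul]
    -- Step (a): `θ n ∈ (ω_n) + (p)` for every `n`
    have step_a : ∀ n, ∃ a t : PowerSeries ℤ_[p],
        θ n = (((X + 1 : ℤ_[p][X]) ^ p ^ n - 1 : ℤ_[p][X]) : PowerSeries ℤ_[p]) * a + PowerSeries.C (p : ℤ_[p]) * t := by
      intro n
      obtain ⟨k, hk⟩ := hgap (p ^ n)
      have hnk : n ≤ nk k := by
        by_contra hlt
        have := pow_lt_pow_right₀ (by exact_mod_cast hp.out.one_lt : (1 : ℕ) < p) (not_le.mp hlt)
        omega
      obtain ⟨u, v, huv⟩ := mem_span_sup_span_iff.mp (hyp k)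
      obtain ⟨w, hw⟩ := C_dvd_X_pow_sub_omega p (nk k)
      have hωk : (((X + 1 : ℤ_[p][X]) ^ p ^ nk k - 1 : ℤ_[p][X]) : PowerSeries ℤ_[p]) =
          (PowerSeries.X : PowerSeries ℤ_[p]) ^ p ^ nk k - PowerSeries.C (p : ℤ_[p]) * w := by
        rw [← hw, sub_sub_cancel]
      have h1 : θ (nk k) * (F k : PowerSeries ℤ_[p]) =
          (PowerSeries.X : PowerSeries ℤ_[p]) ^ p ^ nk k * u +
            PowerSeries.C (p : ℤ_[p]) * (PowerSeries.C ((p : ℤ_[p]) ^ J) * v - w * u) := by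
        rw [huv, hCsucc, hωk]; ring
      obtain ⟨c, d, hcd⟩ := exists_eq_X_pow_mul_add_of_mul_coe_eq p (hF k) (by omega) h1
      obtain ⟨w', hw'⟩ := C_dvd_X_pow_sub_omega p n
      have hXn : (PowerSeries.X : PowerSeries ℤ_[p]) ^ p ^ n =
          (((X + 1 : ℤ_[p][X]) ^ p ^ n - 1 : ℤ_[p][X]) : PowerSeries ℤ_[p]) + PowerSeries.C (p : ℤ_[p]) * w' := by
        rw [← hw', add_sub_cancel]
      obtain ⟨wc, hwc⟩ := hcompat n (nk k) hnk
      obtain ⟨u', v', huv'⟩ := mem_span_sup_span_iff.mp hwc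
      have e1 : (PowerSeries.X : PowerSeries ℤ_[p]) ^ (p ^ nk k - (F k).natDegree) =
          (PowerSeries.X : PowerSeries ℤ_[p]) ^ p ^ n * PowerSeries.X ^ (p ^ nk k - (F k).natDegree - p ^ n) := by
        rw [← pow_add]; congr 1; omega
      refine ⟨wc * PowerSeries.X ^ (p ^ nk k - (F k).natDegree - p ^ n) * c - u',
        wc * w' * PowerSeries.X ^ (p ^ nk k - (F k).natDegree - p ^ n) * c + wc * d - PowerSeries.C ((p : ℤ_[p]) ^ J) * v', ?_⟩
      have e2 : θ n = wc * θ (nk k) - (wc * θ (nk k) - θ n) := by ring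
      rw [e2, huv', hcd, e1, hXn, hCsucc]; ring
    choose a t hat using step_a
    -- Step (b): `t` is compatible modulo `I(·, J)` up to the same coefficients
    have hcompat' : ∀ n m : ℕ, n ≤ m → ∃ w : PowerSeries ℤ_[p], w * t m - t n ∈
        Ideal.span {(((X + 1 : ℤ_[p][X]) ^ p ^ n - 1 : ℤ_[p][X]) : PowerSeries ℤ_[p])} ⊔
          Ideal.span {PowerSeries.C ((p : ℤ_[p]) ^ J)} := by
      intro n m hnm
      obtain ⟨wc, hwc⟩ := hcompat n m hnm
      obtain ⟨u, v, huv⟩ := mem_span_sup_span_iff.mp hwc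
      obtain ⟨ν, hν⟩ := hdiv hnm
      rw [hat m, hat n, hν, hCsucc] at huv
      have h2 : PowerSeries.C (p : ℤ_[p]) * (wc * t m - t n - PowerSeries.C ((p : ℤ_[p]) ^ J) * v) =
          (((X + 1 : ℤ_[p][X]) ^ p ^ n - 1 : ℤ_[p][X]) : PowerSeries ℤ_[p]) * (u + a n - ν * wc * a m) := by
        linear_combination huv
      obtain ⟨e, he⟩ := C_dvd_of_coe_mul_dvd p (hω n) ⟨_, h2.symm⟩
      rw [he, mul_left_comm] at h2
      have h3 := mul_left_cancel₀ hCp h2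
      exact ⟨wc, mem_span_sup_span_iff.mpr ⟨e, v, by linear_combination h3⟩⟩
    -- Step (c): the hypothesis for `t` at level `J`
    have hyp' : ∀ k, t (nk k) * (F k : PowerSeries ℤ_[p]) ∈
        Ideal.span {(((X + 1 : ℤ_[p][X]) ^ p ^ nk k - 1 : ℤ_[p][X]) : PowerSeries ℤ_[p])} ⊔
          Ideal.span {PowerSeries.C ((p : ℤ_[p]) ^ J)} := by
      intro k
      obtain ⟨u, v, huv⟩ := mem_span_sup_span_iff.mp (hyp k)
      rw [hat (nk k), hCsucc] at huv
      have h2 : PowerSeries.C (p : ℤ_[p]) * (t (nk k) * (F k : PowerSeries ℤ_[p]) - PowerSeries.C ((p : ℤ_[p]) ^ J) * v) =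
          (((X + 1 : ℤ_[p][X]) ^ p ^ nk k - 1 : ℤ_[p][X]) : PowerSeries ℤ_[p]) * (u - a (nk k) * (F k : PowerSeries ℤ_[p])) := by
        linear_combination huv
      obtain ⟨e, he⟩ := C_dvd_of_coe_mul_dvd p (hω (nk k)) ⟨_, h2.symm⟩
      rw [he, mul_left_comm] at h2
      have h3 := mul_left_cancel₀ hCp h2
      exact mem_span_sup_span_iff.mpr ⟨e, v, by linear_combination h3⟩
    have ht := ih t hcompat' hyp'
    intro n
    obtain ⟨e, v, hev⟩ := mem_span_sup_span_iff.mp (ht n)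
    refine mem_span_sup_span_iff.mpr ⟨a n + PowerSeries.C (p : ℤ_[p]) * e, v, ?_⟩
    rw [hat n, hev, hCsucc]; ring

end Theta

/-! ## §2 Adjoint congruences (palindromy of cyclotomic products and of the relative norm) -/

section Adjoint

variable {R : Type*} [CommRing R]

/-- **Adjoint of a geometric sum**: if `u^N ≡ 1 (mod 𝔞)` then
`u^{(q−1)a}·∑_{j<q} (u^{N−1})^{aj} ≡ ∑_{j<q} u^{aj} (mod 𝔞)` (substitute `u^{N−1} = u^{−1}` and reflect `j ↦ q−1−j`): the polynomial
`Φ_{q^{m+1}}(Y) = ∑_{j<q} Y^{q^m j}` is palindromic. [folklore] -/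
theorem pow_mul_geom_sum_adjoint_sub_mem {𝔞 : Ideal R} {u : R} {N : ℕ} (hN : 0 < N) (hu : u ^ N - 1 ∈ 𝔞) (q a : ℕ) :
    u ^ ((q - 1) * a) * (∑ j ∈ range q, ((u ^ (N - 1)) ^ a) ^ j) - ∑ j ∈ range q, (u ^ a) ^ j ∈ 𝔞 := by
  rw [← Ideal.Quotient.eq_zero_iff_mem, map_sub, map_mul, map_pow, map_sum, map_sum, sub_eq_zero, Finset.mul_sum,
    ← Finset.sum_range_reflect (fun j ↦ Ideal.Quotient.mk 𝔞 ((u ^ a) ^ j)) q]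
  set v : R ⧸ 𝔞 := Ideal.Quotient.mk 𝔞 u with hv
  have hvN : v ^ N = 1 := by
    rw [hv, ← map_pow, ← sub_eq_zero, ← map_one (Ideal.Quotient.mk 𝔞), ← map_sub, Ideal.Quotient.eq_zero_iff_mem]
    exact hu
  refine Finset.sum_congr rfl fun j hj ↦ ?_
  have hj' : j < q := Finset.mem_range.mp hj
  obtain ⟨i, hi⟩ : ∃ i, q - 1 = i + j := ⟨q - 1 - j, by omega⟩
  obtain ⟨N', rfl⟩ : ∃ N', N = N' + 1 := ⟨N - 1, by omega⟩
  rw [map_pow, map_pow, map_pow, map_pow, map_pow, show q - 1 - j = i by omega, hi, Nat.add_sub_cancel, ← hv,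
    ← pow_mul, ← pow_mul, ← pow_mul, ← pow_add]
  have hexp : (i + j) * a + N' * (a * j) = a * i + (N' + 1) * (a * j) := by ring
  rw [hexp, pow_add, pow_mul v (N' + 1), hvN, one_pow, mul_one]

/-- `Φ_{q^{a+1}}(u) = ∑_{j<q} (u^{q^a})^j` for a prime `q`. [folklore] -/
theorem aeval_cyclotomic_prime_pow_succ [Algebra ℤ R] (u : R) {q : ℕ} (hq : q.Prime) (a : ℕ) :
    aeval u (cyclotomic (q ^ (a + 1)) ℤ) = ∑ j ∈ range q, (u ^ q ^ a) ^ j := by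
  rw [cyclotomic_prime_pow_eq_geom_sum hq, map_sum]
  simp only [map_pow, aeval_X]

/-- **Adjoint of a product of cyclotomic polynomials `Q = ∏_{k∈K} Φ_{q^{m_k+1}}`**: if `u^N ≡ 1 (mod 𝔞)` then
`u^{deg Q}·Q(u^{N−1}) ≡ Q(u) (mod 𝔞)`, `deg Q = ∑_k (q−1)q^{m_k}` (each factor is palindromic; congruences multiply). Used with
`u = 1 + T`, `N = pⁿ`, `𝔞 = (ω_n)` and `Q(T' ) = ω̃⁻_n(T' − 1)`. [cite: BDKim2007, Prop. 3.15 (proof)] [cite: Pollack2003, §6.5] -/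
theorem pow_mul_aeval_prod_cyclotomic_adjoint_sub_mem [Algebra ℤ R] {𝔞 : Ideal R} {u : R} {N : ℕ} (hN : 0 < N) (hu : u ^ N - 1 ∈ 𝔞)
    {q : ℕ} (hq : q.Prime) (K : Finset ℕ) (m : ℕ → ℕ) :
    u ^ (∑ k ∈ K, (q - 1) * q ^ m k) * aeval (u ^ (N - 1)) (∏ k ∈ K, cyclotomic (q ^ (m k + 1)) ℤ) -
      aeval u (∏ k ∈ K, cyclotomic (q ^ (m k + 1)) ℤ) ∈ 𝔞 := by
  induction K using Finset.induction_on with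
  | empty => rw [sum_empty, prod_empty, pow_zero, map_one, map_one, one_mul, sub_self]; exact zero_mem _
  | insert k K hk ih =>
    rw [sum_insert hk, prod_insert hk, map_mul, map_mul, pow_add]
    have h1 := pow_mul_geom_sum_adjoint_sub_mem hN hu q (q ^ m k)
    rw [← aeval_cyclotomic_prime_pow_succ _ hq, ← aeval_cyclotomic_prime_pow_succ _ hq] at h1
    have e1 : u ^ ((q - 1) * q ^ m k) * u ^ (∑ k ∈ K, (q - 1) * q ^ m k) *
          (aeval (u ^ (N - 1)) (cyclotomic (q ^ (m k + 1)) ℤ) * aeval (u ^ (N - 1)) (∏ k ∈ K, cyclotomic (q ^ (m k + 1)) ℤ)) -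
        aeval u (cyclotomic (q ^ (m k + 1)) ℤ) * aeval u (∏ k ∈ K, cyclotomic (q ^ (m k + 1)) ℤ) =
      (u ^ ((q - 1) * q ^ m k) * aeval (u ^ (N - 1)) (cyclotomic (q ^ (m k + 1)) ℤ)) *
          (u ^ (∑ k ∈ K, (q - 1) * q ^ m k) * aeval (u ^ (N - 1)) (∏ k ∈ K, cyclotomic (q ^ (m k + 1)) ℤ) -
            aeval u (∏ k ∈ K, cyclotomic (q ^ (m k + 1)) ℤ)) +
        (u ^ ((q - 1) * q ^ m k) * aeval (u ^ (N - 1)) (cyclotomic (q ^ (m k + 1)) ℤ) -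
          aeval u (cyclotomic (q ^ (m k + 1)) ℤ)) * aeval u (∏ k ∈ K, cyclotomic (q ^ (m k + 1)) ℤ) := by ring
    rw [e1]
    exact add_mem (Ideal.mul_mem_left _ _ ih) (Ideal.mul_mem_right _ _ h1)

/-- **`ω̃⁻_n` as a product of cyclotomic polynomials in `1 + T`**, evaluated: for `y` in a `ℤ`-algebra,
`ω̃⁻_n(y) = (∏_{1≤k≤(n+1)/2} Φ_{p^{(2k−2)+1}})(y + 1)`. [cite: Pollack2003, §6.5 (display before Prop. 6.18)] -/
theorem aeval_cyclotomicOmegaMinus_eq_aeval_add_one {A : Type*} [CommRing A] [Algebra ℤ A] (p : ℕ) (n : ℕ) (y : A) :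
    aeval y (cyclotomicOmegaMinus p n) =
      aeval (y + 1) (∏ k ∈ Icc 1 ((n + 1) / 2), cyclotomic (p ^ (2 * k - 2 + 1)) ℤ) := by
  rw [cyclotomicOmegaMinus, map_prod, map_prod]
  refine Finset.prod_congr rfl fun k hk ↦ ?_
  rw [aeval_comp, map_add, aeval_X, map_one, show 2 * k - 2 + 1 = 2 * k - 1 by have := (Finset.mem_Icc.mp hk).1; omega]

variable (p : ℕ) [hp : Fact p.Prime]

/-- `1 + T` is a unit of `Λ`. [folklore] -/
theorem isUnit_one_add_X : IsUnit (1 + PowerSeries.X : PowerSeries ℤ_[p]) := by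
  rw [PowerSeries.isUnit_iff_constantCoeff, map_add, map_one, PowerSeries.constantCoeff_X, add_zero]
  exact isUnit_one

/-- `(1+T)^{pⁿ} − 1 ∈ (ω_n)` (it IS `ω_n`). [cite: Washington1997, §13.2] -/
theorem one_add_X_pow_sub_one_mem_span_omega (n : ℕ) :
    (1 + PowerSeries.X : PowerSeries ℤ_[p]) ^ p ^ n - 1 ∈
      Ideal.span {(((X + 1 : ℤ_[p][X]) ^ p ^ n - 1 : ℤ_[p][X]) : PowerSeries ℤ_[p])} := by
  rw [UniversalToricDescentTorsionFreeByCount.coe_omega p n]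
  exact Ideal.mem_span_singleton_self _

/-- **PALINDROMY OF `ω̃⁻_n` modulo `ω_n`** in `Λ`: with `u = 1 + T` and `d = deg ω̃⁻_n = ∑_k (p−1)p^{2k−2}`,
`u^d · ω̃⁻_n(u^{pⁿ−1} − 1) − ω̃⁻_n(T) ∈ (ω_n)` — the adjoint `γ ↦ γ^{−1} = γ^{pⁿ−1}` of the layer group ring maps `ω̃⁻_n(γ − 1)` to a
UNIT multiple of itself. [cite: BDKim2007, Prop. 3.15 (proof)] [cite: Pollack2003, §6.5] -/
theorem adjoint_cyclotomicOmegaMinus_sub_mem (n : ℕ) :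
    (1 + PowerSeries.X : PowerSeries ℤ_[p]) ^ (∑ k ∈ Icc 1 ((n + 1) / 2), (p - 1) * p ^ (2 * k - 2)) *
        aeval ((1 + PowerSeries.X : PowerSeries ℤ_[p]) ^ (p ^ n - 1) - 1) (cyclotomicOmegaMinus p n) -
      aeval (PowerSeries.X : PowerSeries ℤ_[p]) (cyclotomicOmegaMinus p n) ∈
      Ideal.span {(((X + 1 : ℤ_[p][X]) ^ p ^ n - 1 : ℤ_[p][X]) : PowerSeries ℤ_[p])} := by
  rw [aeval_cyclotomicOmegaMinus_eq_aeval_add_one, aeval_cyclotomicOmegaMinus_eq_aeval_add_one, sub_add_cancel, add_comm _ (1 : PowerSeries ℤ_[p])]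
  exact pow_mul_aeval_prod_cyclotomic_adjoint_sub_mem (pow_pos hp.out.pos n) (one_add_X_pow_sub_one_mem_span_omega p n) hp.out _ _

/-- **PALINDROMY OF THE RELATIVE NORM `ν = Φ_{p^{n+1}}(1+T) = ∑_{i<p}(1+T)^{pⁿ i}` modulo `ω_{n+1}`**: its adjoint
`ν((1+T)^{p^{n+1}−1})` is congruent to `ν` itself (the general adjoint congruence gives `u^{(p−1)pⁿ}ν^† ≡ ν`, and `ν·u^{pⁿ} ≡ ν`
because `ν·(u^{pⁿ} − 1) = ω_{n+1}`; cancel the unit). [cite: BDKim2007, Prop. 3.15 (proof, «Cor^m_n»)] [cite: Washington1997, §13.2] -/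
theorem aeval_norm_adjoint_sub_mem (n : ℕ) :
    aeval ((1 + PowerSeries.X : PowerSeries ℤ_[p]) ^ (p ^ (n + 1) - 1)) (cyclotomic (p ^ (n + 1)) ℤ) -
        aeval (1 + PowerSeries.X : PowerSeries ℤ_[p]) (cyclotomic (p ^ (n + 1)) ℤ) ∈
      Ideal.span {(((X + 1 : ℤ_[p][X]) ^ p ^ (n + 1) - 1 : ℤ_[p][X]) : PowerSeries ℤ_[p])} := by
  set u : PowerSeries ℤ_[p] := 1 + PowerSeries.X with hu
  set 𝔞 : Ideal (PowerSeries ℤ_[p]) := Ideal.span {(((X + 1 : ℤ_[p][X]) ^ p ^ (n + 1) - 1 : ℤ_[p][X]) : PowerSeries ℤ_[p])}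
  set ν : PowerSeries ℤ_[p] := aeval u (cyclotomic (p ^ (n + 1)) ℤ) with hν
  set ν' : PowerSeries ℤ_[p] := aeval (u ^ (p ^ (n + 1) - 1)) (cyclotomic (p ^ (n + 1)) ℤ) with hν'
  -- (1) `u^{(p−1)pⁿ}·ν' − ν ∈ 𝔞`
  have h1 : u ^ ((p - 1) * p ^ n) * ν' - ν ∈ 𝔞 := by
    have := pow_mul_geom_sum_adjoint_sub_mem (pow_pos hp.out.pos (n + 1)) (one_add_X_pow_sub_one_mem_span_omega p (n + 1)) p (p ^ n)
    rwa [← aeval_cyclotomic_prime_pow_succ _ hp.out, ← aeval_cyclotomic_prime_pow_succ _ hp.out] at this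
  -- (2) `ν·(u^{pⁿ k} − 1) ∈ 𝔞` for every `k` (`ν·(u^{pⁿ} − 1) = ω_{n+1}`)
  have h2 : ∀ k, ν * (u ^ (p ^ n * k) - 1) ∈ 𝔞 := by
    intro k
    have hω : ν * (u ^ p ^ n - 1) = u ^ p ^ (n + 1) - 1 := by
      have := congrArg (aeval u) (cyclotomic_prime_pow_mul_X_pow_sub_one ℤ p n)
      rwa [map_mul, map_sub, map_sub, map_pow, map_pow, aeval_X, map_one] at this
    obtain ⟨c, hc⟩ := sub_dvd_pow_sub_pow (u ^ p ^ n) 1 k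
    rw [one_pow, ← pow_mul] at hc
    rw [hc, ← mul_assoc, hω]
    exact Ideal.mul_mem_right _ _ (one_add_X_pow_sub_one_mem_span_omega p (n + 1))
  -- (3) combine and cancel the unit `u^{(p−1)pⁿ}`
  have h3 : u ^ ((p - 1) * p ^ n) * (ν' - ν) ∈ 𝔞 := by
    have e1 : u ^ ((p - 1) * p ^ n) * (ν' - ν) = (u ^ ((p - 1) * p ^ n) * ν' - ν) - ν * (u ^ (p ^ n * (p - 1)) - 1) := by ring
    rw [e1]
    exact sub_mem h1 (h2 (p - 1))
  exact (Ideal.unit_mul_mem_iff_mem 𝔞 ((isUnit_one_add_X p).pow _)).mp h3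

end Adjoint

/-! ## §3 The degree gap at `p = 2` -/

section Gap

/-- `3·deg ω̃⁻_{2m} + 1 = 4^m` at `p = 2` (`deg ω̃⁻_{2m+2} = deg ω̃⁻_{2m} + 2^{2m}`). [cite: Pollack2003, §6.5 and Lemma 4.7] -/
theorem three_mul_natDegree_cyclotomicOmegaMinus_two_add_one (m : ℕ) :
    3 * (cyclotomicOmegaMinus 2 (2 * m)).natDegree + 1 = 2 ^ (2 * m) := by
  induction m with
  | zero => simp
  | succ m ih =>
    have hq : (X + 1 : ℤ[X]).Monic := by simpa using monic_X_add_C (1 : ℤ)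
    have hqdeg : (X + 1 : ℤ[X]).natDegree = 1 := by simpa using natDegree_X_add_C (1 : ℤ)
    have hc : ((cyclotomic (2 ^ (2 * m + 1)) ℤ).comp (X + 1)).Monic :=
      (cyclotomic.monic _ ℤ).comp hq (by rw [hqdeg]; exact one_ne_zero)
    rw [show 2 * (m + 1) = 2 * m + 2 by ring, cyclotomicOmegaMinus_two_mul_add_two,
      (monic_cyclotomicOmegaMinus 2 (2 * m)).natDegree_mul hc, natDegree_comp, natDegree_cyclotomic, hqdeg, mul_one,
      Nat.totient_prime_pow_succ Nat.prime_two, pow_succ, pow_succ, ← ih]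
    omega

/-- `m ≤ deg ω̃⁻_{2m}` at `p = 2`. [cite: Pollack2003, §6.5 and Lemma 4.7] -/
theorem le_natDegree_cyclotomicOmegaMinus_two (m : ℕ) : m ≤ (cyclotomicOmegaMinus 2 (2 * m)).natDegree := by
  induction m with
  | zero => exact Nat.zero_le _
  | succ m ih =>
    have h1 := three_mul_natDegree_cyclotomicOmegaMinus_two_add_one m
    have h2 := three_mul_natDegree_cyclotomicOmegaMinus_two_add_one (m + 1)
    have h3 : 2 ^ (2 * (m + 1)) = 4 * 2 ^ (2 * m) := by rw [show 2 * (m + 1) = 2 * m + 2 by ring, pow_add]; ring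
    have h4 : 1 ≤ 2 ^ (2 * m) := Nat.one_le_two_pow
    omega

/-- **THE DEGREE GAP**: `∀ N ∃ m, N + deg((ω̃⁻_{2m})²) ≤ 2^{2m}` at `p = 2` (as `2·deg ω̃⁻_{2m} = 2(4^m − 1)/3`): at the even layers the honest
(plus) part `S[2^J, T·ω̃⁺_{2m}]` is two thirds of the layer, so the square of its complement `ω̃⁻_{2m}` still leaves an unbounded
Weierstrass gap. [cite: BDKim2007, Prop. 3.15 (proof, the parity of the layers)] [cite: Pollack2003, §6.5] -/
theorem exists_gap_cyclotomicOmegaMinus_two (N : ℕ) :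
    ∃ m : ℕ, N + ((cyclotomicOmegaMinus 2 (2 * m)).map (Int.castRingHom ℤ_[2]) ^ 2).natDegree ≤ 2 ^ (2 * m) := by
  refine ⟨N, ?_⟩
  rw [natDegree_pow, natDegree_map_eq_of_injective (RingHom.injective_int (Int.castRingHom ℤ_[2]))]
  have h1 := three_mul_natDegree_cyclotomicOmegaMinus_two_add_one N
  have h2 := le_natDegree_cyclotomicOmegaMinus_two N
  omega

end Gap

end Summit.BirchSwinnertonDyer.BirchSwinnertonDyer.Theorems.ResidualThetaLayer.PlusDual

end
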